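import Literature.NumberTheory.EllipticCurves.ProfiniteGroupDistributionCharacterCells
import Literature.NumberTheory.EllipticCurves.ProfiniteGroupDistributionCharacterCellsIndex
import Literature.NumberTheory.EllipticCurves.ProfiniteGroupDistributionDivisionNatCast
import HarnessLib

/-!
# The DIVISION DATA of de Shalit II.4.12 from a character cutting out the tower: `hgen`, `hpow`,
# `hunb`, `hτ` of `exists_twisting_μ_eq_of_cocycle_natCast` for `σ₁` with `κ(σ₁) ≡ 1 mod p^{s+1}`,
# `≢ 1 mod p^{s+2}` — and the `p = 2` clause `s ≥ 1` («`1 + 4ℤ₂` if `p = 2`», II.4.17)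

De Shalit 1987, II.4.12 (p. 66–68): the division `μ(𝔣) = μ_𝔞/12(σ_𝔞 − N𝔞)` uses an ideal `𝔞₁` whose
Artin symbol `σ₁ = σ_{𝔞₁}` "restricted to `Gal(K(𝔣𝔭^∞)/K(𝔣𝔭ˢ))` is a topological generator"; along
`κ : Gal(K(𝔣𝔭^∞)/K(𝔣)) ≅ 𝒪_𝔭ˣ = ℤ_pˣ` (II.1.7, I.3.3 (9)) this says that `κ(σ₁)` topologically generates
`1 + p^{s+1}ℤ_p`, i.e. `κ(σ₁) ≡ 1 mod p^{s+1}`, `≢ 1 mod p^{s+2}` — possible for every `s ≥ 0` at odd `p`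
and for `s ≥ 1` at `p = 2` (`1 + 2ℤ₂ = {±1} × (1 + 4ℤ₂)` is not pro-cyclic: II.4.17 "`1 + 4ℤ₂` if
`p = 2`", p. 78). The tree's division theorem
`GroupDistribution.exists_twisting_μ_eq_of_cocycle_natCast` (`ProfiniteGroupDistributionDivisionNatCast.lean`)
asks for this in tower currency: `hgen` (`σ₁` generates `U_s` modulo every `U_m`), `hpow`/`hunb` (the
order of `σ₁` modulo `U_n` is an unbounded power of `p`), `hτ` (`σ₂ᵏσ₁⁻ᵏ ∉ U_n` for some `n`).

THIS FILE derives them for ANY subgroup tower `𝒰` of a group `G` cut out by a character `κ : G →* ℤ_pˣ`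
(the frame of `ProfiniteGroupDistributionCharacterCells.lean`: `hU : σ ∈ U_n ↔ σ ∈ U_0 ∧ κ σ ≡ 1 mod p^{n+1}`,
`hκ : κ mod p^{n+1}` maps `U_0` onto the classes `≡ 1 mod p`), from the single datum
`κ(σ₁) ≡ 1 mod p^{s+1}`, `κ(σ₁) ≢ 1 mod p^{s+2}` and the parity clause `p = 2 → 1 ≤ s`:

* §1 `(ℤ/p^{m+1})ˣ`: `natCard_ker_unitsMap_pow_succ` (`#ker((ℤ/p^{m+1})ˣ → (ℤ/p^{s+1})ˣ) = p^{m−s}`),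
  `orderOf_unitsMap_toZModPow_eq` (**the class of `u` has order `p^{m−s}` in `(ℤ/p^{m+1})ˣ`** when
  `u ≡ 1 mod p^{s+1}`, `≢ mod p^{s+2}`, `p = 2 → 1 ≤ s` — lifting the exponent, the tree's
  `TwistingDiv.padicValNat_pow_sub_one` on a natural representative), `zpowers_eq_ker_of_toZModPow`
  (it generates the kernel);
* §2 tower: `proj_eq_proj_iff_toZModPow_eq` (on `U_0`, `σU_m = τU_m ↔ κσ ≡ κτ mod p^{m+1}`),
  ★ `orderOf_proj_eq_pow` (`orderOf (σ₁U_n) = p^{n−s}` for `n ≥ s`), ★ `hpow_of_character`,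
  ★ `hunb_of_character`, ★★ `hgen_of_character` (`∀ m ≥ s, ∀ u ∈ U_s, ∃ k, σ₁ᵏU_m = uU_m`),
  ★ `hτ_of_character` (from `κ(σ₂)ᵏ ≠ κ(σ₁)ᵏ` for `k > 0`), `hcent_of_commutator_le` — the hypotheses of
  `exists_twisting_μ_eq_of_cocycle_natCast` VERBATIM.

Consumers: the global ray class towers `rayAdicTower` of `NumberFields/RayClassFieldAdicCharacterTower.lean`
with `κ_p = e ∘ rayAdicCharacter` and `σ₁ = σ_{(α₁)}`, `κ(σ_{(α)}) = α_v⁻¹`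
(`RayClassFieldAdicCharacterPrincipal.lean`); the Lubin–Tate towers `ltTower`/`ltRelTower`.
Everything is a theorem; no definitions, no named facts, no instances, no `sorry`.

## References

* [deShalit1987] E. de Shalit, *Iwasawa theory of elliptic curves with complex multiplication* (1987),
  II.4.12 (p. 66–68), II.4.17 (p. 77–78), I.3.3 (9) (p. 18).
* [Washington1997] L. Washington, *Introduction to Cyclotomic Fields*, 2nd ed., Lemma 13.? / §7.2
  (lifting the exponent; structure of `(ℤ/p^{m})ˣ`).
-/

noncomputable section

open scoped Classical

namespace Literature.NumberTheory.EllipticCurves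

/-! ### §1. `(ℤ/p^{m+1})ˣ`: the kernel of reduction to `(ℤ/p^{s+1})ˣ` is cyclic, generated by any
`u ≡ 1 mod p^{s+1}`, `≢ 1 mod p^{s+2}` (`p = 2 → 1 ≤ s`) -/

section ZModUnits

variable {p : ℕ} [hp : Fact p.Prime]

/-- **`#ker((ℤ/p^{m+1})ˣ → (ℤ/p^{s+1})ˣ) = p^{m−s}`** for `s ≤ m` (`φ(p^{m+1})/φ(p^{s+1})`; the reduction
is onto). [cite: deShalit1987, II.1.9 (p. 43)] -/
theorem PadicInt.natCard_ker_unitsMap_pow_succ {s m : ℕ} (h : s ≤ m) :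
    Nat.card (ZMod.unitsMap (pow_dvd_pow p (Nat.succ_le_succ h)) :
      (ZMod (p ^ (m + 1)))ˣ →* (ZMod (p ^ (s + 1)))ˣ).ker = p ^ (m - s) := by
  have hP : p.Prime := hp.out
  haveI : NeZero (p ^ (m + 1)) := ⟨pow_ne_zero _ hP.ne_zero⟩
  set f : (ZMod (p ^ (m + 1)))ˣ →* (ZMod (p ^ (s + 1)))ˣ :=
    ZMod.unitsMap (pow_dvd_pow p (Nat.succ_le_succ h)) with hf
  have hsurj : Function.Surjective f := ZMod.unitsMap_surjective _
  have h1 : Nat.card f.ker * Nat.card (ZMod (p ^ (s + 1)))ˣ = Nat.card (ZMod (p ^ (m + 1)))ˣ := by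
    rw [← Nat.card_congr (QuotientGroup.quotientKerEquivOfSurjective f hsurj).toEquiv,
      mul_comm, ← Subgroup.index_eq_card, Subgroup.index_mul_card]
  rw [PadicInt.natCard_units_zmod_pow_succ, PadicInt.natCard_units_zmod_pow_succ,
    show p ^ m = p ^ (m - s) * p ^ s by rw [← pow_add, Nat.sub_add_cancel h], mul_assoc] at h1
  exact Nat.eq_of_mul_eq_mul_right (Nat.mul_pos (pow_pos hP.pos _) (by have := hP.two_le; omega)) h1

/-- A natural representative of `u mod p^{m+1}` with `u ≡ 1 mod p^{s+1}`, `u ≢ 1 mod p^{s+2}`, `s + 1 ≤ m`: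
`N ≥ 2`, `p ∣ N − 1` (`4 ∣ N − 1` if `p = 2` and `1 ≤ s`), and `v_p(N − 1) = s + 1`.
[cite: deShalit1987, II.4.12 (p. 67)] -/
theorem PadicInt.exists_natCast_eq_toZModPow {s m : ℕ} (hsm : s + 1 ≤ m) (u : ℤ_[p])
    (h1 : PadicInt.toZModPow (s + 1) u = 1) (h2 : PadicInt.toZModPow (s + 2) u ≠ 1) :
    ∃ N : ℕ, (N : ZMod (p ^ (m + 1))) = PadicInt.toZModPow (m + 1) u ∧ 2 ≤ N ∧
      padicValNat p (N - 1) = s + 1 := by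
  have hP : p.Prime := hp.out
  haveI : NeZero (p ^ (m + 1)) := ⟨pow_ne_zero _ hP.ne_zero⟩
  set N : ℕ := (PadicInt.toZModPow (m + 1) u).val with hN
  -- `N mod p^k = u mod p^k` for `k ≤ m + 1`
  have hcast : ∀ k, k ≤ m + 1 → (N : ZMod (p ^ k)) = PadicInt.toZModPow k u := fun k hk ↦ by
    rw [hN, ← ZMod.cast_eq_val, PadicInt.cast_toZModPow k (m + 1) hk]
  have hs1 : (N : ZMod (p ^ (s + 1))) = 1 := by rw [hcast (s + 1) (by omega), h1]
  have hs2 : (N : ZMod (p ^ (s + 2))) ≠ 1 := by rw [hcast (s + 2) (by omega)]; exact h2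
  have hp1 : 1 < p ^ (s + 1) := Nat.one_lt_pow (by omega) hP.one_lt
  haveI : Fact (1 < p ^ (s + 1)) := ⟨hp1⟩
  haveI : NeZero (p ^ (s + 1)) := ⟨pow_ne_zero _ hP.ne_zero⟩
  haveI : NeZero (p ^ (s + 2)) := ⟨pow_ne_zero _ hP.ne_zero⟩
  have hN1 : 1 ≤ N := by
    by_contra h0
    have : N = 0 := by omega
    rw [this, Nat.cast_zero] at hs1
    exact zero_ne_one hs1
  have hN2 : 2 ≤ N := by
    by_contra h0
    have : N = 1 := by omega
    rw [this, Nat.cast_one] at hs2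
    exact hs2 rfl
  -- `p^{s+1} ∣ N - 1`, `p^{s+2} ∤ N - 1`
  have hdvd : p ^ (s + 1) ∣ N - 1 := by
    rw [← ZMod.natCast_eq_zero_iff, Nat.cast_sub hN1, Nat.cast_one, hs1, sub_self]
  have hndvd : ¬ p ^ (s + 2) ∣ N - 1 := by
    rw [← ZMod.natCast_eq_zero_iff, Nat.cast_sub hN1, Nat.cast_one, sub_eq_zero]
    exact hs2
  refine ⟨N, ZMod.natCast_zmod_val _, hN2, ?_⟩
  have hne : N - 1 ≠ 0 := by omega
  have hle : s + 1 ≤ padicValNat p (N - 1) := (padicValNat_dvd_iff_le hne).mp hdvd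
  have hlt : ¬ s + 2 ≤ padicValNat p (N - 1) := fun h ↦ hndvd ((padicValNat_dvd_iff_le hne).mpr h)
  omega

/-- **Lifting the exponent in `(ℤ/p^{m+1})ˣ`: for `u ≡ 1 mod p^{s+1}`, `u ≢ 1 mod p^{s+2}` (`p = 2 → 1 ≤ s`)
and `s ≤ m`: `u^k ≡ 1 mod p^{m+1} ↔ p^{m−s} ∣ k`** (`v_p(N^k − 1) = v_p(N − 1) + v_p(k)`, the tree's
`TwistingDiv.padicValNat_pow_sub_one`, on a natural representative `N` of `u`).
[cite: deShalit1987, II.4.12 (p. 67), II.4.17 (p. 78)] [cite: Washington1997, §7.2] -/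
theorem PadicInt.unitsMap_toZModPow_pow_eq_one_iff {s m : ℕ} (hsm : s ≤ m) (u : ℤ_[p]ˣ)
    (h1 : PadicInt.toZModPow (s + 1) (u : ℤ_[p]) = 1) (h2 : PadicInt.toZModPow (s + 2) (u : ℤ_[p]) ≠ 1)
    (hp2 : p = 2 → 1 ≤ s) (k : ℕ) :
    (Units.map (PadicInt.toZModPow (p := p) (m + 1)).toMonoidHom u) ^ k = 1 ↔ p ^ (m - s) ∣ k := by
  have hP : p.Prime := hp.out
  haveI : NeZero (p ^ (m + 1)) := ⟨pow_ne_zero _ hP.ne_zero⟩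
  rcases Nat.eq_or_lt_of_le hsm with rfl | hlt
  · -- `m = s`: the class of `u` is trivial
    rw [Nat.sub_self, pow_zero]
    simp only [one_dvd, iff_true]
    have hx : Units.map (PadicInt.toZModPow (p := p) (s + 1)).toMonoidHom u = 1 := by
      ext; rw [Units.coe_map, RingHom.toMonoidHom_eq_coe, MonoidHom.coe_coe, h1, Units.val_one]
    rw [hx, one_pow]
  · obtain ⟨N, hN, hN2, hv⟩ := PadicInt.exists_natCast_eq_toZModPow (Nat.succ_le_of_lt hlt) (u : ℤ_[p]) h1 h2
    have hpN : p ∣ N - 1 := by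
      have h := (padicValNat_dvd_iff_le (show N - 1 ≠ 0 by omega)).mpr (show 1 ≤ padicValNat p (N - 1) by omega)
      rwa [pow_one] at h
    have h4 : p = 2 → 4 ∣ N - 1 := fun h2' ↦ by
      have h := (padicValNat_dvd_iff_le (show N - 1 ≠ 0 by omega)).mpr
        (show 2 ≤ padicValNat p (N - 1) by have := hp2 h2'; omega)
      rwa [h2', show (2 : ℕ) ^ 2 = 4 by norm_num] at h
    -- `x^k = 1 ↔ N^k ≡ 1 mod p^{m+1}`
    have hxk : (Units.map (PadicInt.toZModPow (p := p) (m + 1)).toMonoidHom u) ^ k = 1 ↔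
        ((N ^ k : ℕ) : ZMod (p ^ (m + 1))) = 1 := by
      rw [← Units.val_eq_one, Units.val_pow_eq_pow_val, Units.coe_map, RingHom.toMonoidHom_eq_coe,
        MonoidHom.coe_coe, ← hN, Nat.cast_pow]
    rw [hxk]
    rcases Nat.eq_zero_or_pos k with rfl | hk
    · simp
    have hNk : 1 ≤ N ^ k := Nat.one_le_pow _ _ (by omega)
    rw [show ((N ^ k : ℕ) : ZMod (p ^ (m + 1))) = 1 ↔ ((N ^ k - 1 : ℕ) : ZMod (p ^ (m + 1))) = 0 by
        rw [Nat.cast_sub hNk, Nat.cast_one, sub_eq_zero],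
      ZMod.natCast_eq_zero_iff, padicValNat_dvd_iff_le (show N ^ k - 1 ≠ 0 by
        have : 1 < N ^ k := Nat.one_lt_pow hk.ne' (by omega)
        omega),
      TwistingDiv.padicValNat_pow_sub_one hN2 hpN h4 hk.ne', hv, padicValNat_dvd_iff_le hk.ne']
    omega

/-- **The class of `u` has order `p^{m−s}` in `(ℤ/p^{m+1})ˣ`** (`u ≡ 1 mod p^{s+1}`, `≢ mod p^{s+2}`,
`p = 2 → 1 ≤ s`, `s ≤ m`). [cite: deShalit1987, II.4.12 (p. 67)] [cite: Washington1997, §7.2] -/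
theorem PadicInt.orderOf_unitsMap_toZModPow_eq {s m : ℕ} (hsm : s ≤ m) (u : ℤ_[p]ˣ)
    (h1 : PadicInt.toZModPow (s + 1) (u : ℤ_[p]) = 1) (h2 : PadicInt.toZModPow (s + 2) (u : ℤ_[p]) ≠ 1)
    (hp2 : p = 2 → 1 ≤ s) :
    orderOf (Units.map (PadicInt.toZModPow (p := p) (m + 1)).toMonoidHom u) = p ^ (m - s) := by
  refine Nat.dvd_antisymm ?_ ?_
  · exact orderOf_dvd_of_pow_eq_one
      ((PadicInt.unitsMap_toZModPow_pow_eq_one_iff hsm u h1 h2 hp2 _).mpr dvd_rfl)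
  · exact (PadicInt.unitsMap_toZModPow_pow_eq_one_iff hsm u h1 h2 hp2 _).mp (pow_orderOf_eq_one _)

/-- The class of `u` (`≡ 1 mod p^{s+1}`) lies in `ker((ℤ/p^{m+1})ˣ → (ℤ/p^{s+1})ˣ)`.
[cite: deShalit1987, II.1.9 (p. 43)] -/
theorem PadicInt.unitsMap_toZModPow_mem_ker {s m : ℕ} (hsm : s ≤ m) (u : ℤ_[p]ˣ)
    (h1 : PadicInt.toZModPow (s + 1) (u : ℤ_[p]) = 1) :
    Units.map (PadicInt.toZModPow (p := p) (m + 1)).toMonoidHom u ∈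
      (ZMod.unitsMap (pow_dvd_pow p (Nat.succ_le_succ hsm)) :
        (ZMod (p ^ (m + 1)))ˣ →* (ZMod (p ^ (s + 1)))ˣ).ker := by
  have hP : p.Prime := hp.out
  haveI : NeZero (p ^ (m + 1)) := ⟨pow_ne_zero _ hP.ne_zero⟩
  rw [MonoidHom.mem_ker, ← Units.val_eq_one, ZMod.unitsMap_val, Units.coe_map,
    RingHom.toMonoidHom_eq_coe, MonoidHom.coe_coe, PadicInt.cast_toZModPow (s + 1) (m + 1)
      (Nat.succ_le_succ hsm), h1]

/-- ★ **`ker((ℤ/p^{m+1})ˣ → (ℤ/p^{s+1})ˣ)` is cyclic, generated by the class of any `u ≡ 1 mod p^{s+1}`,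
`u ≢ 1 mod p^{s+2}`** (`p = 2 → 1 ≤ s`): both have `p^{m−s}` elements — de Shalit's «`1 + p^{s+1}ℤ_p`
topologically generated by `κ(σ_𝔞)`», «`1 + 4ℤ₂` if `p = 2`». [cite: deShalit1987, II.4.12 (p. 67), II.4.17 (p. 78)] -/
theorem PadicInt.zpowers_unitsMap_toZModPow_eq_ker {s m : ℕ} (hsm : s ≤ m) (u : ℤ_[p]ˣ)
    (h1 : PadicInt.toZModPow (s + 1) (u : ℤ_[p]) = 1) (h2 : PadicInt.toZModPow (s + 2) (u : ℤ_[p]) ≠ 1)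
    (hp2 : p = 2 → 1 ≤ s) :
    Subgroup.zpowers (Units.map (PadicInt.toZModPow (p := p) (m + 1)).toMonoidHom u) =
      (ZMod.unitsMap (pow_dvd_pow p (Nat.succ_le_succ hsm)) :
        (ZMod (p ^ (m + 1)))ˣ →* (ZMod (p ^ (s + 1)))ˣ).ker := by
  refine Subgroup.eq_of_le_of_card_ge ?_ ?_
  · rw [Subgroup.zpowers_le]
    exact PadicInt.unitsMap_toZModPow_mem_ker hsm u h1
  · rw [PadicInt.natCard_ker_unitsMap_pow_succ hsm, Nat.card_zpowers,
      PadicInt.orderOf_unitsMap_toZModPow_eq hsm u h1 h2 hp2]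

end ZModUnits

/-! ### §2. The tower: `hgen`, `hpow`, `hunb`, `hτ`, `hcent` of `exists_twisting_μ_eq_of_cocycle_natCast` -/

namespace SubgroupTower

variable {G : Type*} [Group G] (𝒰 : SubgroupTower G) [∀ n, (𝒰.U n).Normal]
variable {p : ℕ} [hp : Fact p.Prime] (κ : G →* ℤ_[p]ˣ)
  (hU : ∀ (n : ℕ) (σ : G), σ ∈ 𝒰.U n ↔ σ ∈ 𝒰.U 0 ∧ PadicInt.toZModPow (n + 1) (κ σ : ℤ_[p]) = 1)

omit [∀ n, (𝒰.U n).Normal] in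
include hU in
/-- **On `U_0` the character decides the cells**: `σU_m = τU_m ↔ κσ ≡ κτ mod p^{m+1}` for `σ, τ ∈ U_0`.
[cite: deShalit1987, I.3.3 (9) (p. 18)] -/
theorem proj_eq_proj_iff_toZModPow_eq (m : ℕ) {σ τ : G} (hσ : σ ∈ 𝒰.U 0) (hτ : τ ∈ 𝒰.U 0) :
    𝒰.proj m σ = 𝒰.proj m τ ↔
      PadicInt.toZModPow (m + 1) (κ σ : ℤ_[p]) = PadicInt.toZModPow (m + 1) (κ τ : ℤ_[p]) := by
  rw [𝒰.proj_eq_iff, hU, PadicInt.toZModPow_coe_eq_iff_inv_mul, ← map_inv, ← map_mul]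
  exact ⟨fun h ↦ h.2, fun h ↦ ⟨mul_mem (inv_mem hσ) hτ, h⟩⟩

omit [∀ n, (𝒰.U n).Normal] in
include hU in
/-- `σ ∈ U_0` and `κσ ≡ 1 mod p^{s+1}` put `σ` in `U_s`. [cite: deShalit1987, I.3.3 (9) (p. 18)] -/
theorem mem_U_of_toZModPow_eq_one {s : ℕ} {σ : G} (hσ : σ ∈ 𝒰.U 0)
    (h1 : PadicInt.toZModPow (s + 1) (κ σ : ℤ_[p]) = 1) : σ ∈ 𝒰.U s :=
  (hU s σ).mpr ⟨hσ, h1⟩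

include hU in
/-- `(σU_n)^k = 1 ↔ (κσ mod p^{n+1})^k = 1` for `σ ∈ U_0`. [cite: deShalit1987, I.3.3 (9) (p. 18)] -/
theorem proj_pow_eq_one_iff (n : ℕ) {σ : G} (hσ : σ ∈ 𝒰.U 0) (k : ℕ) :
    𝒰.proj n σ ^ k = 1 ↔ (Units.map (PadicInt.toZModPow (p := p) (n + 1)).toMonoidHom (κ σ)) ^ k = 1 := by
  rw [← 𝒰.proj_pow, ← 𝒰.proj_one n, 𝒰.proj_eq_proj_iff_toZModPow_eq κ hU n (pow_mem hσ k) (one_mem _),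
    map_pow, Units.val_pow_eq_pow_val, map_pow, map_one, Units.val_one, map_one, ← Units.val_eq_one,
    Units.val_pow_eq_pow_val, Units.coe_map, RingHom.toMonoidHom_eq_coe, MonoidHom.coe_coe]

include hU in
/-- ★ **`orderOf (σ₁U_n) = p^{n−s}`** for `n ≥ s`, `σ₁ ∈ U_0` with `κσ₁ ≡ 1 mod p^{s+1}`, `≢ 1 mod p^{s+2}`
(`p = 2 → 1 ≤ s`) — de Shalit's `[K(𝔣𝔭^{n+1}) : K(𝔣𝔭^{s+1})] = p^{n−s}` with `σ_𝔞` a generator.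
[cite: deShalit1987, II.4.12 (p. 67), II.1.9 (p. 43)] -/
theorem orderOf_proj_eq_pow {s n : ℕ} (hsn : s ≤ n) {σ₁ : G} (hσ₁ : σ₁ ∈ 𝒰.U 0)
    (h1 : PadicInt.toZModPow (s + 1) (κ σ₁ : ℤ_[p]) = 1) (h2 : PadicInt.toZModPow (s + 2) (κ σ₁ : ℤ_[p]) ≠ 1)
    (hp2 : p = 2 → 1 ≤ s) : orderOf (𝒰.proj n σ₁) = p ^ (n - s) := by
  rw [← PadicInt.orderOf_unitsMap_toZModPow_eq hsn (κ σ₁) h1 h2 hp2]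
  exact orderOf_eq_orderOf_iff.mpr fun k ↦ 𝒰.proj_pow_eq_one_iff κ hU n hσ₁ k

include hU in
/-- ★ **`hpow`**: the order of `σ₁` modulo `U_n` is a power of `p` (`n ≥ s`).
[cite: deShalit1987, II.4.12 (p. 67)] -/
theorem hpow_of_character {s : ℕ} {σ₁ : G} (hσ₁ : σ₁ ∈ 𝒰.U 0)
    (h1 : PadicInt.toZModPow (s + 1) (κ σ₁ : ℤ_[p]) = 1) (h2 : PadicInt.toZModPow (s + 2) (κ σ₁ : ℤ_[p]) ≠ 1)
    (hp2 : p = 2 → 1 ≤ s) : ∀ n, s ≤ n → ∃ a : ℕ, orderOf (𝒰.proj n σ₁) = p ^ a :=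
  fun n hn ↦ ⟨n - s, 𝒰.orderOf_proj_eq_pow κ hU hn hσ₁ h1 h2 hp2⟩

include hU in
/-- ★ **`hunb`**: the orders of `σ₁` modulo `U_m` are unbounded powers of `p`.
[cite: deShalit1987, II.4.12 (p. 67)] -/
theorem hunb_of_character {s : ℕ} {σ₁ : G} (hσ₁ : σ₁ ∈ 𝒰.U 0)
    (h1 : PadicInt.toZModPow (s + 1) (κ σ₁ : ℤ_[p]) = 1) (h2 : PadicInt.toZModPow (s + 2) (κ σ₁ : ℤ_[p]) ≠ 1)
    (hp2 : p = 2 → 1 ≤ s) : ∀ a : ℕ, ∃ m, p ^ a ∣ orderOf (𝒰.proj m σ₁) :=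
  fun a ↦ ⟨s + a, by rw [𝒰.orderOf_proj_eq_pow κ hU (Nat.le_add_right s a) hσ₁ h1 h2 hp2, Nat.add_sub_cancel_left]⟩

omit [∀ n, (𝒰.U n).Normal] in
include hU in
/-- ★★ **`hgen`: `σ₁` generates `U_s` modulo every `U_m`** (`m ≥ s`): for `u ∈ U_s` there is `k` with
`σ₁ᵏU_m = uU_m` — because `κσ₁ mod p^{m+1}` generates `ker((ℤ/p^{m+1})ˣ → (ℤ/p^{s+1})ˣ) ∋ κu`
(`PadicInt.zpowers_unitsMap_toZModPow_eq_ker`). At `p = 2` this needs `s ≥ 1`: `Gal(K(𝔣𝔭^{m+1})/K(𝔣𝔭))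
≅ (ℤ/2^{m+1})ˣ ⊇ {±1}` is not cyclic — de Shalit's «`1 + 4ℤ₂` if `p = 2`».
[cite: deShalit1987, II.4.12 (p. 66–67), II.4.17 (p. 78)] -/
theorem hgen_of_character {s : ℕ} {σ₁ : G} (hσ₁ : σ₁ ∈ 𝒰.U 0)
    (h1 : PadicInt.toZModPow (s + 1) (κ σ₁ : ℤ_[p]) = 1) (h2 : PadicInt.toZModPow (s + 2) (κ σ₁ : ℤ_[p]) ≠ 1)
    (hp2 : p = 2 → 1 ≤ s) : ∀ m, s ≤ m → ∀ u ∈ 𝒰.U s, ∃ k : ℕ, 𝒰.proj m (σ₁ ^ k) = 𝒰.proj m u := by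
  intro m hsm u hu
  have hP : p.Prime := hp.out
  haveI : NeZero (p ^ (m + 1)) := ⟨pow_ne_zero _ hP.ne_zero⟩
  obtain ⟨hu0, hu1⟩ := (hU s u).mp hu
  -- `κu mod p^{m+1}` lies in the kernel, which `κσ₁ mod p^{m+1}` generates
  have hmem : Units.map (PadicInt.toZModPow (p := p) (m + 1)).toMonoidHom (κ u) ∈
      Subgroup.zpowers (Units.map (PadicInt.toZModPow (p := p) (m + 1)).toMonoidHom (κ σ₁)) := by
    rw [PadicInt.zpowers_unitsMap_toZModPow_eq_ker hsm (κ σ₁) h1 h2 hp2]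
    exact PadicInt.unitsMap_toZModPow_mem_ker hsm (κ u) hu1
  obtain ⟨k, hk⟩ := (mem_zpowers_iff_mem_range_orderOf.mp hmem : _) |> Finset.mem_image.mp
  refine ⟨k, ?_⟩
  rw [𝒰.proj_eq_proj_iff_toZModPow_eq κ hU m (pow_mem hσ₁ k) hu0, map_pow, Units.val_pow_eq_pow_val, map_pow]
  have hk' := congrArg (fun x : (ZMod (p ^ (m + 1)))ˣ ↦ (x : ZMod (p ^ (m + 1)))) hk.2
  simp only [Units.val_pow_eq_pow_val, Units.coe_map, RingHom.toMonoidHom_eq_coe, MonoidHom.coe_coe] at hk'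
  exact hk'

omit [∀ n, (𝒰.U n).Normal] in
include hU in
/-- ★ **`hτ`**: if `κ(σ₂)ᵏ ≠ κ(σ₁)ᵏ` for every `k > 0` (e.g. `κσ₂/κσ₁` of infinite order), then for every
`k > 0` some level `n ≥ s` separates `σ₂ᵏσ₁⁻ᵏ` from `1`. [cite: deShalit1987, II.4.12 (p. 67–68)] -/
theorem hτ_of_character (s : ℕ) {σ₁ σ₂ : G}
    (hne : ∀ k : ℕ, 0 < k → (κ σ₂ : ℤ_[p]) ^ k ≠ (κ σ₁ : ℤ_[p]) ^ k) :
    ∀ k, 0 < k → ∃ n, s ≤ n ∧ σ₂ ^ k * (σ₁ ^ k)⁻¹ ∉ 𝒰.U n := by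
  intro k hk
  by_contra hall
  simp only [not_exists, not_and, not_not] at hall
  apply hne k hk
  -- `κ(σ₂ᵏσ₁⁻ᵏ) ≡ 1` modulo every `p^{n+1}`, hence `= 1`
  have hmem : ∀ n, σ₂ ^ k * (σ₁ ^ k)⁻¹ ∈ 𝒰.U n := fun n ↦
    𝒰.le_of_le (le_max_right s n) (hall (max s n) (le_max_left s n))
  have h1 : (κ (σ₂ ^ k * (σ₁ ^ k)⁻¹) : ℤ_[p]) = 1 := by
    refine PadicInt.ext_of_toZModPow.mp fun n ↦ ?_
    rw [map_one]
    rcases n with _ | n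
    · haveI : Subsingleton (ZMod (p ^ 0)) := by rw [pow_zero]; infer_instance
      exact Subsingleton.elim _ _
    · exact ((hU n _).mp (hmem n)).2
  rw [map_mul, map_inv, map_pow, map_pow, Units.val_mul, Units.mul_inv_eq_one, Units.val_pow_eq_pow_val,
    Units.val_pow_eq_pow_val] at h1
  exact h1

omit [∀ n, (𝒰.U n).Normal] in
/-- **`hcent`** from commutators: if `[G, G] ≤ U_m` for every `m` (e.g. `G` inside an absolute Galois group
and `U_m` the fixers of ABELIAN extensions), `U_s` is central modulo every level.
[cite: deShalit1987, II.4.12 (p. 66)] -/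
theorem hcent_of_commutator_le (hcomm : ∀ m, commutator G ≤ 𝒰.U m) (s : ℕ) :
    ∀ m, ∀ g : G, ∀ u ∈ 𝒰.U s, g * u * g⁻¹ * u⁻¹ ∈ 𝒰.U m :=
  fun m g u _ ↦ hcomm m (Subgroup.commutator_mem_commutator (Subgroup.mem_top g) (Subgroup.mem_top u))

end SubgroupTower

end Literature.NumberTheory.EllipticCurves

end
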